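import Summits.BirchSwinnertonDyer.BirchSwinnertonDyer.Theorems.SignedLowerHalvesKobayashiLowerHalfLargeImageCommonZeroSqueezeSignBlindDefect
import Summits.BirchSwinnertonDyer.BirchSwinnertonDyer.Theorems.SignedLowerHalvesKobayashiLowerHalfLargeImageMuPartAlgebra
import Literature.NumberTheory.EllipticCurves.Kobayashi2003.SignedColemanKatoZetaJoint
import Literature.NumberTheory.EllipticCurves.TateModuleFreeProofs
import HarnessLib

/-!
# Route `SignedLowerHalves` (K3), crux L `SmallImageLowerHalfBothSigns` (item stmt-BirchSwinnertonDyer-23599), line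
# `birth_acns` v14, stub `stub_muBothSigns_ns`: THE SIGN-BLIND `μ`/`λ`-DEFECT AT ANY IMAGE, and what it makes of the
# both-signs rider — «second sign ⟺ equal algebraic `μ`», «stub ⟺ one-sign floor ∧ M∀» modulo print
# (cell `bsd-ssimc`, width seat `bsd-line-slh-p3-w2` gen 4; helper file `--supports 23599`; THEOREMS ONLY, route-independent)

HONEST FRAMING.  Nothing here proves the stub (`stub-misstated`, gens 0/2/3), child L, child M, crux 4 or BSD.  Every
theorem is CONDITIONAL on displayed PUBLISHED binders taken BY NAME: the JOINT `±` Coleman–Kato package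
`Kobayashi2003.thm62_63_73_signedColemanKato_zetaJoint` (`hCKJ`: Kobayashi Thm. 6.2/6.3/7.3 i) + proof of 7.4 with Kato
12.5/12.6 — both signs on ONE zeta submodule), Kobayashi Thm. 1.2 (`h12`), the period units `h5`/`h3` (Greenberg–Vatsal
Rem. 3.4 / Mazur), and — only where the brick of line `birth_mu` is invoked — modularity-with-parametrisation `hmodP`.
NO Kato Thm. 4.1, NO lower half (child L), NO image hypothesis in §1–§2.

WHAT.  Kobayashi's proof of Thm. 7.4 gives, per sign and per dual datum, `(ξ^ε)·char(𝐇¹/Z) = (L_p^ε)·char(X₀)`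
(tree: `CommonZeroSqueeze.charGen_mul_charIdeal_eq_of_signedColemanKato`, image-free).  On the JOINT package the two
identities share `char(𝐇¹/Z)` and `char(X₀)`, so (§1, `mu_add_mu_kobayashiL_comm`):

  `μ(ξ^ε) + μ(L_p^{ε'}) = μ(ξ^{ε'}) + μ(L_p^ε)`  and  `λ(ξ^ε) + λ(L_p^{ε'}) = λ(ξ^{ε'}) + λ(L_p^ε)`

for ANY two signs `ε, ε'` and ANY dual data `D^ε, D^{ε'}` of `Sel^ε(E/ℚ_∞)`, `Sel^{ε'}(E/ℚ_∞)` — at EVERY odd good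
supersingular prime with `a_p = 0`, ANY image (irreducibility of `E[p]` is Serre's Prop. 12), any newform level.  The
tree had this «sign-blind defect» only at SURJECTIVE image and through Kato's Thm. 4.1 (`signBlindDefect_of_jointPackages`,
p618204, crux 19001); gen 3 of this seat named the identity in its memo but did not type it.

CONSEQUENCES for the stub (§2 here; §2′–§4 in part 2 `…MuRiderMuDefectSigns.lean`, same namespace):
* §2 `hasUnitContent_iff_mu_eq_of_hasUnitContent` — given the FLOOR sign `ε₀` (`μ(L_p^{ε₀}) = 0`; input-free at `p = 3`,
  ⟸ B⁰ at `p ≥ 5`), the OTHER sign has `μ(L_p^{ε'}) = 0` IFF `μ(ξ^{ε'}) = μ(ξ^{ε₀})` — the second sign of Pollack's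
  conjecture IS «equal algebraic `μ` of the two signed Selmer groups»; `forall_hasUnitContent_iff_floor_and_mu_eq` —
  both signs ⟺ floor ∧ `μ(ξ⁺) = μ(ξ⁻)`; `mu_kobayashiL_eq_mu_sub_mu` — `μ(L_p^{ε'}) = μ(ξ^{ε'}) − μ(ξ^{ε₀})`.
* §2′ with the BRICK of line `birth_mu` (`SmallImageMuControl.mu_eq_zero_of_isSignedPAdicLFunction_of_hasUnitContent`,
  NON-surjective image, `hCK := hCKJ` projected): `μ(ξ^{ε₀}) = 0`, hence `μ(L_p^{ε'}) = μ(ξ^{ε'})` — at small image the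
  second sign's ANALYTIC `μ` equals its ALGEBRAIC `μ`; both-signs rider at the pair ⟺ floor ∧ `∀ ε D ξ, μ(ξ) = 0`.
* §3 `p = 3` (floor input-free, THEOREM B): the `p = 3` slice of the rider at a pair ⟺ `∀ ε D ξ, μ(ξ) = 0` (M∀ at the
  pair); class-wide by name: `muBothSigns_iff_oneSign_and_muAllSigns` — the registered stub text ⟺ (the one-sign
  rider text at `p ≥ 5` = retired 23117 `SmallImageOneSignUnitContent` body) ∧ (M's body with `∃ ε` replaced by `∀ ε`),
  modulo `hCKJ h12 h5 h3 hmodP` — compare DOSSIER-23599-23600 (B2) «M ⟺ 23117 modulo L ∧ print»: here NO L.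

References: [Kobayashi2003] Thm. 1.2 (p. 2), Thm. 5.2 iv) (p. 9), Thm. 6.2–6.3 (p. 11), Thm. 7.3 i) (7.21), proof of
Thm. 7.4 (p. 13); [Kato2004Asterisque] Thm. 12.5–12.6 (p. 222); [GreenbergVatsal2000] p. 2 (1)–(2), §3 Rem. 3.4;
[Pollack2003] Conj. 6.3 (p. 548), Cor. 5.11; [PerrinRiou2003] §6.1 Conj. 6.1.1; [Serre1972] §1.11 Prop. 12.
-/

-- D-0017: single-problem summit, the namespace repeats the problem name by design.
set_option linter.dupNamespace false
set_option autoImplicit false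

noncomputable section

open scoped Classical MatrixGroups ModularForm

open CongruenceSubgroup WeierstrassCurve Field
  Literature.NumberTheory.EllipticCurves Literature.NumberTheory.EllipticCurves.ModularForms
  Literature.NumberTheory.GaloisRepresentations Literature.NumberTheory.EllipticCurves.Rank1Residual
  Literature.NumberTheory.EllipticCurves.Kobayashi2003 Literature.NumberTheory.EllipticCurves.GreenbergVatsal2000
  ZpExtension
  Summit.BirchSwinnertonDyer.Rank1Residual.Supersingular Summit.BirchSwinnertonDyer.Rank1Residual.X1.MuLambda
  Summit.BirchSwinnertonDyer.Rank1Residual.X11a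

namespace Summit.BirchSwinnertonDyer.BirchSwinnertonDyer.Theorems.SmallImageLowerHalfBothSignsMuRiderMuDefect

open Summit.BirchSwinnertonDyer.BirchSwinnertonDyer.Theorems.CommonZeroSqueeze
  (charGen_mul_charIdeal_eq_of_signedColemanKato)
open Summit.BirchSwinnertonDyer.BirchSwinnertonDyer.Theorems.LargeImageMuPart (mu_eq_and_lam_eq_of_span_eq)

/-! ## §1 The sign-blind `μ`/`λ`-defect at ANY image -/

section Defect

variable (W : WeierstrassCurve ℚ) [W.IsElliptic] [W.IsGloballyMinimal] (p : ℕ) [Fact p.Prime]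

/-- **The sign-blind defect, any image.**  `W/ℚ` globally minimal, `p` ODD of good reduction with `a_p = 0`, `(κ, γ)`
the cyclotomic frame matching the variable, `f` a newform of `W` (any level) with a Pollack pair `(L⁺, L⁻)`; `D`, `D'`
Pontryagin-dual data of `Sel^ε(E/ℚ_∞)`, `Sel^{ε'}(E/ℚ_∞)` (ANY two signs) with `char = (ξ)`, `(ξ')`.  GRANTED `hCKJ`
(joint `±` package on one zeta line), `h12` (torsion), `h5`/`h3` (period units):
`μ(ξ) + μ(L_p^{ε'}) = μ(ξ') + μ(L_p^ε)` and `λ(ξ) + λ(L_p^{ε'}) = λ(ξ') + λ(L_p^ε)` (`L_p^ε = kobayashiL ε L⁺ L⁻`).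
Proof: pin `I = 𝐇¹(T)^Δ`, `Y = X₀`; on the joint package both signs give `(ξ^•)·(α) = (L_p^•)·(β)` with the SAME
`(α) = char(𝐇¹/Z)`, `(β) = char(X₀)` (`charGen_mul_charIdeal_eq_of_signedColemanKato`, `E[p]` irreducible by Serre
Prop. 12); `μ`, `λ` are additive on non-zero products and constant on associates.  NO image hypothesis, NO Thm. 4.1.
[cite: Kobayashi2003, Thm. 7.3 i) (7.21) and proof of Thm. 7.4 (p. 13), Thm. 5.2 iv) (p. 9)]
[cite: Kato2004Asterisque, Thm. 12.6 (p. 222)] [cite: GreenbergVatsal2000, p. 2 (1)–(2), §3 Remark 3.4]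
[cite: Serre1972, §1.11 Prop. 12] -/
theorem mu_add_mu_kobayashiL_comm
    (hCKJ : thm62_63_73_signedColemanKato_zetaJoint) (h12 : thm12_signedSelmerDual_finite_torsion)
    (h5 : realPeriodRat_eq_unit_mul_plusPeriod) (h3 : realPeriodRat_eq_unit_mul_plusPeriod_three)
    (hp2 : p ≠ 2) (hgood : W.HasGoodReductionAtPrime p) (hap : W.frobeniusTrace p = 0)
    {κ : ZpExtension ℚ p} {γ : absoluteGaloisGroup ℚ} (hκ : κ.IsCyclotomic) (hγ : κ.IsTopGenerator γ)
    (hγc : IsCyclotomicVariable p γ)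
    {N : ℕ} [NeZero N] {f : CuspForm (Gamma0 N) 2} (hf : IsNewformOf W f)
    {Lplus Lminus : IwasawaAlgebra p} (hL : IsPollackPair f p Lplus Lminus)
    {ε ε' : ℤˣ} (D : SignedSelmerDualData W κ γ ε) (D' : SignedSelmerDualData W κ γ ε')
    {ξ ξ' : IwasawaAlgebra p} (hξ : D.charIdeal = Ideal.span {ξ}) (hξ' : D'.charIdeal = Ideal.span {ξ'}) :
    mu ξ + mu (kobayashiL ε' Lplus Lminus) = mu ξ' + mu (kobayashiL ε Lplus Lminus) ∧
      lam ξ + lam (kobayashiL ε' Lplus Lminus) = lam ξ' + lam (kobayashiL ε Lplus Lminus) := by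
  have hpP : p.Prime := Fact.out
  haveI : ContinuousSMul ℤ_[p] (W.tateModule p) := TateModule.continuousSMul_padicInt
  haveI : Module.Free ℤ_[p] (W.tateModule p) := W.module_free_tateModule_holds p
  haveI : Module.Finite ℤ_[p] (W.tateModule p) := W.module_finite_tateModule_holds p
  have hirr : W.HasIrreducibleModPGaloisRep p :=
    hasIrreducibleModPGaloisRep_of_dvd_frobeniusTrace W p hp2
      (W.not_dvd_minimalDiscriminantInt_of_hasGoodReductionAtPrime' p hgood) (by rw [hap]; exact dvd_zero _)
  -- the period ratio `ϖ = u⁻¹`, a `p`-adic unit (Greenberg–Vatsal / Mazur)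
  have hper : ∃ u : ℚ, ‖(u : ℚ_[p])‖ = 1 ∧ W.realPeriodRat = u * plusPeriod f := by
    rcases Nat.lt_or_ge p 5 with hlt | hge
    · have h2 := hpP.two_le
      have hp3 : p = 3 := by
        interval_cases p
        · exact absurd rfl hp2
        · rfl
        · exact absurd hpP (by decide)
      subst hp3
      exact h3 W hgood hirr f hf
    · exact h5 W p hge hgood hirr f hf
  obtain ⟨u, hu1, hu⟩ := hper
  have hu0 : u ≠ 0 := by
    rintro rfl
    simp at hu1
  have hϖ : ((u⁻¹ : ℚ) : ℝ) * W.realPeriodRat = plusPeriod f := by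
    rw [hu, Rat.cast_inv, ← mul_assoc, inv_mul_cancel₀ (by exact_mod_cast hu0), one_mul]
  have hvϖ : padicValRat p (u⁻¹ : ℚ) = 0 := by
    rw [padicValRat.inv, padicValRat_eq_zero_of_norm_ratCast_eq_one hu1, neg_zero]
  -- pin `𝐇¹(T)`, `X₀`; the JOINT packages on one zeta submodule
  obtain ⟨I⟩ := Kato2004.nonempty_iwasawaH1Data_holds W p κ γ hκ hγ
  obtain ⟨Y⟩ := W.nonempty_fineSelmerDualData κ hγ
  obtain ⟨dp, dm, hZ⟩ := hCKJ W p f (u⁻¹ : ℚ) κ γ hp2 hgood hap hf hϖ hκ hγ hγc I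
  -- `A = char(𝐇¹/Z) = (α)`, `char(X₀) = (β)`
  set A : Ideal (IwasawaAlgebra p) := Module.charIdeal (IwasawaAlgebra p) (I.H ⧸ dp.Z) with hAdef
  have hAm : Module.charIdeal (IwasawaAlgebra p) (I.H ⧸ dm.Z) = A := by
    rw [hAdef, hZ]
  obtain ⟨α, hα⟩ := (charIdeal_isPrincipal_holds p (I.H ⧸ dp.Z)).principal
  have hA : A = Ideal.span {α} := hα
  obtain ⟨β, hβ⟩ := (charIdeal_isPrincipal_holds p Y.X).principal
  have hB : Module.charIdeal (IwasawaAlgebra p) Y.X = Ideal.span {β} := hβ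
  -- Kobayashi's `L^ε ≠ 0`
  have hLne : ∀ ε₁ : ℤˣ, kobayashiL ε₁ Lplus Lminus ≠ 0 := by
    intro ε₁
    unfold kobayashiL
    split_ifs
    · exact hL.2.1
    · exact hL.1
  -- the per-sign identity on the package of sign `ε₁` (same `Z`): `(ξ₁ α) = (L^{ε₁} β)` and `(ξ₁) = char`
  have hid : ∀ (ε₁ : ℤˣ) (D₁ : SignedSelmerDualData W κ γ ε₁) (ξ₁ : IwasawaAlgebra p),
      D₁.charIdeal = Ideal.span {ξ₁} →
      mu ξ₁ + mu α = mu (kobayashiL ε₁ Lplus Lminus) + mu β ∧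
        lam ξ₁ + lam α = lam (kobayashiL ε₁ Lplus Lminus) + lam β := by
    intro ε₁ D₁ ξ₁ hξ₁
    obtain ⟨-, htor⟩ := h12 W p hp2 hgood hap κ γ hκ hγ ε₁ D₁
    have key : ∃ ξ₂ : IwasawaAlgebra p, D₁.charIdeal = Ideal.span {ξ₂} ∧
        Ideal.span {ξ₂} * A = Ideal.span {kobayashiL ε₁ Lplus Lminus} * Ideal.span {β} := by
      rcases Int.units_eq_one_or ε₁ with rfl | rfl
      · obtain ⟨ξ₂, hξ₂, h⟩ :=
          charGen_mul_charIdeal_eq_of_signedColemanKato W p hirr hγ hf hϖ hvϖ hL D₁ htor Y dp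
        exact ⟨ξ₂, hξ₂, by rw [← hB]; exact h⟩
      · obtain ⟨ξ₂, hξ₂, h⟩ :=
          charGen_mul_charIdeal_eq_of_signedColemanKato W p hirr hγ hf hϖ hvϖ hL D₁ htor Y dm
        exact ⟨ξ₂, hξ₂, by rw [← hAm, ← hB]; exact h⟩
    obtain ⟨ξ₂, hξ₂, h⟩ := key
    rw [hA, Ideal.span_singleton_mul_span_singleton, Ideal.span_singleton_mul_span_singleton] at h
    -- non-vanishing: `L β ≠ 0`, hence `ξ₂ α ≠ 0`
    have hβ0 : β ≠ 0 := by
      intro h0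
      exact Module.charIdeal_ne_bot (IwasawaAlgebra p) Y.X (by rw [hB, h0, Ideal.span_singleton_eq_bot])
    have hLβ : kobayashiL ε₁ Lplus Lminus * β ≠ 0 := mul_ne_zero (hLne ε₁) hβ0
    have hξα : ξ₂ * α ≠ 0 := by
      intro h0
      rw [h0, Ideal.span_singleton_eq_bot.mpr rfl, eq_comm, Ideal.span_singleton_eq_bot] at h
      exact hLβ h
    have hξ₂0 : ξ₂ ≠ 0 := left_ne_zero_of_mul hξα
    have hα0 : α ≠ 0 := right_ne_zero_of_mul hξα
    -- `ξ₁ ~ ξ₂`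
    have h12' : Ideal.span {ξ₂} = Ideal.span ({ξ₁} : Set (IwasawaAlgebra p)) := by rw [← hξ₂, hξ₁]
    obtain ⟨hμ12, hlam12⟩ := mu_eq_and_lam_eq_of_span_eq hξ₂0 h12'
    obtain ⟨hμ, hlam⟩ := mu_eq_and_lam_eq_of_span_eq hξα h
    rw [mu_mul hξ₂0 hα0, mu_mul (hLne ε₁) hβ0] at hμ
    rw [lam_mul hξ₂0 hα0, lam_mul (hLne ε₁) hβ0] at hlam
    rw [← hμ12, ← hlam12]
    exact ⟨hμ, hlam⟩
  obtain ⟨hμ, hlam⟩ := hid ε D ξ hξ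
  obtain ⟨hμ', hlam'⟩ := hid ε' D' ξ' hξ'
  constructor <;> omega

/-- **Two dual data of the SAME sign have the same `μ` and `λ`** (special case `ε = ε'`; also a consequence of the
tree's uniqueness of `Sel^ε` up to isomorphism — here read off the package).
[cite: Kobayashi2003, Thm. 1.2 (p. 2), Thm. 7.3 i) (7.21)] -/
theorem mu_eq_and_lam_eq_of_sameSign
    (hCKJ : thm62_63_73_signedColemanKato_zetaJoint) (h12 : thm12_signedSelmerDual_finite_torsion)
    (h5 : realPeriodRat_eq_unit_mul_plusPeriod) (h3 : realPeriodRat_eq_unit_mul_plusPeriod_three)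
    (hp2 : p ≠ 2) (hgood : W.HasGoodReductionAtPrime p) (hap : W.frobeniusTrace p = 0)
    {κ : ZpExtension ℚ p} {γ : absoluteGaloisGroup ℚ} (hκ : κ.IsCyclotomic) (hγ : κ.IsTopGenerator γ)
    (hγc : IsCyclotomicVariable p γ)
    {N : ℕ} [NeZero N] {f : CuspForm (Gamma0 N) 2} (hf : IsNewformOf W f)
    {ε : ℤˣ} (D D' : SignedSelmerDualData W κ γ ε)
    {ξ ξ' : IwasawaAlgebra p} (hξ : D.charIdeal = Ideal.span {ξ}) (hξ' : D'.charIdeal = Ideal.span {ξ'}) :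
    mu ξ = mu ξ' ∧ lam ξ = lam ξ' := by
  obtain ⟨Lplus, Lminus, hL⟩ :=
    exists_isPollackPair pollack_exists_plusMinusPAdicLFunction_holds hp2 hf hgood hap
  obtain ⟨hμ, hlam⟩ := mu_add_mu_kobayashiL_comm W p hCKJ h12 h5 h3 hp2 hgood hap hκ hγ hγc hf hL D D' hξ hξ'
  constructor <;> omega

end Defect

/-! ## §2 The second sign ⟺ equal algebraic `μ` (given the floor sign) -/

section SecondSign

variable (W : WeierstrassCurve ℚ) [W.IsElliptic] [W.IsGloballyMinimal] (p : ℕ) [Fact p.Prime]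

/-- **`μ(L_p^{ε'}) = μ(ξ^{ε'}) − μ(ξ^{ε₀})` given the floor sign `ε₀`** (`μ(L_p^{ε₀}) = 0`, i.e. unit content): the
analytic `μ` of the OTHER sign is the excess of the algebraic `μ` of `Sel^{ε'}` over that of `Sel^{ε₀}` (and
`μ(ξ^{ε₀}) ≤ μ(ξ^{ε'})`).  Any image; GRANTED `hCKJ h12 h5 h3`.
[cite: Kobayashi2003, proof of Thm. 7.4 (p. 13)] [cite: GreenbergVatsal2000, p. 2 (2)] -/
theorem mu_kobayashiL_eq_mu_sub_mu
    (hCKJ : thm62_63_73_signedColemanKato_zetaJoint) (h12 : thm12_signedSelmerDual_finite_torsion)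
    (h5 : realPeriodRat_eq_unit_mul_plusPeriod) (h3 : realPeriodRat_eq_unit_mul_plusPeriod_three)
    (hp2 : p ≠ 2) (hgood : W.HasGoodReductionAtPrime p) (hap : W.frobeniusTrace p = 0)
    {κ : ZpExtension ℚ p} {γ : absoluteGaloisGroup ℚ} (hκ : κ.IsCyclotomic) (hγ : κ.IsTopGenerator γ)
    (hγc : IsCyclotomicVariable p γ)
    {N : ℕ} [NeZero N] {f : CuspForm (Gamma0 N) 2} (hf : IsNewformOf W f)
    {Lplus Lminus : IwasawaAlgebra p} (hL : IsPollackPair f p Lplus Lminus)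
    {ε₀ ε' : ℤˣ} (hfloor : HasUnitContent (kobayashiL ε₀ Lplus Lminus))
    (D₀ : SignedSelmerDualData W κ γ ε₀) (D' : SignedSelmerDualData W κ γ ε')
    {ξ₀ ξ' : IwasawaAlgebra p} (hξ₀ : D₀.charIdeal = Ideal.span {ξ₀}) (hξ' : D'.charIdeal = Ideal.span {ξ'}) :
    mu ξ₀ ≤ mu ξ' ∧ mu (kobayashiL ε' Lplus Lminus) = mu ξ' - mu ξ₀ := by
  obtain ⟨hμ, -⟩ := mu_add_mu_kobayashiL_comm W p hCKJ h12 h5 h3 hp2 hgood hap hκ hγ hγc hf hL D₀ D' hξ₀ hξ'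
  have h0 : mu (kobayashiL ε₀ Lplus Lminus) = 0 := mu_eq_zero_of_hasUnitContent hfloor
  constructor <;> omega

/-- **THE SECOND SIGN ⟺ EQUAL ALGEBRAIC `μ`.**  Given the floor sign `ε₀` (`L_p^{ε₀}` of unit content), the other
signed function `L_p^{ε'}` has unit content IFF `μ(ξ^{ε'}) = μ(ξ^{ε₀})` for (any) dual data of the two signed Selmer
groups.  Any image; GRANTED `hCKJ h12 h5 h3`.  (So Pollack's both-signs conjecture at a supersingular pair = the floor
+ «`Sel⁺(E/ℚ_∞)` and `Sel⁻(E/ℚ_∞)` have the same `μ`-invariant».)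
[cite: Pollack2003, Conj. 6.3 (p. 548)] [cite: Kobayashi2003, proof of Thm. 7.4 (p. 13)] [cite: PerrinRiou2003, §6.1 Conj. 6.1.1] -/
theorem hasUnitContent_iff_mu_eq_of_hasUnitContent
    (hCKJ : thm62_63_73_signedColemanKato_zetaJoint) (h12 : thm12_signedSelmerDual_finite_torsion)
    (h5 : realPeriodRat_eq_unit_mul_plusPeriod) (h3 : realPeriodRat_eq_unit_mul_plusPeriod_three)
    (hp2 : p ≠ 2) (hgood : W.HasGoodReductionAtPrime p) (hap : W.frobeniusTrace p = 0)
    {κ : ZpExtension ℚ p} {γ : absoluteGaloisGroup ℚ} (hκ : κ.IsCyclotomic) (hγ : κ.IsTopGenerator γ)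
    (hγc : IsCyclotomicVariable p γ)
    {N : ℕ} [NeZero N] {f : CuspForm (Gamma0 N) 2} (hf : IsNewformOf W f)
    {Lplus Lminus : IwasawaAlgebra p} (hL : IsPollackPair f p Lplus Lminus)
    {ε₀ ε' : ℤˣ} (hfloor : HasUnitContent (kobayashiL ε₀ Lplus Lminus))
    (D₀ : SignedSelmerDualData W κ γ ε₀) (D' : SignedSelmerDualData W κ γ ε')
    {ξ₀ ξ' : IwasawaAlgebra p} (hξ₀ : D₀.charIdeal = Ideal.span {ξ₀}) (hξ' : D'.charIdeal = Ideal.span {ξ'}) :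
    HasUnitContent (kobayashiL ε' Lplus Lminus) ↔ mu ξ' = mu ξ₀ := by
  obtain ⟨hle, hμ⟩ :=
    mu_kobayashiL_eq_mu_sub_mu W p hCKJ h12 h5 h3 hp2 hgood hap hκ hγ hγc hf hL hfloor D₀ D' hξ₀ hξ'
  have hLne : kobayashiL ε' Lplus Lminus ≠ 0 := by
    unfold kobayashiL
    split_ifs
    · exact hL.2.1
    · exact hL.1
  constructor
  · intro hu
    have := mu_eq_zero_of_hasUnitContent hu
    omega
  · intro heq
    exact hasUnitContent_of_mu_eq_zero hLne (by omega)

/-- **BOTH SIGNS ⟺ FLOOR ∧ `μ(ξ⁺) = μ(ξ⁻)`** at a pair (any image), for any dual data `D₊`, `D₋` of the two signed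
Selmer groups; GRANTED `hCKJ h12 h5 h3`. [cite: Pollack2003, Conj. 6.3 (p. 548)] [cite: Kobayashi2003, proof of Thm. 7.4 (p. 13)] -/
theorem forall_hasUnitContent_iff_floor_and_mu_eq
    (hCKJ : thm62_63_73_signedColemanKato_zetaJoint) (h12 : thm12_signedSelmerDual_finite_torsion)
    (h5 : realPeriodRat_eq_unit_mul_plusPeriod) (h3 : realPeriodRat_eq_unit_mul_plusPeriod_three)
    (hp2 : p ≠ 2) (hgood : W.HasGoodReductionAtPrime p) (hap : W.frobeniusTrace p = 0)
    {κ : ZpExtension ℚ p} {γ : absoluteGaloisGroup ℚ} (hκ : κ.IsCyclotomic) (hγ : κ.IsTopGenerator γ)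
    (hγc : IsCyclotomicVariable p γ)
    {N : ℕ} [NeZero N] {f : CuspForm (Gamma0 N) 2} (hf : IsNewformOf W f)
    {Lplus Lminus : IwasawaAlgebra p} (hL : IsPollackPair f p Lplus Lminus)
    (Dp : SignedSelmerDualData W κ γ 1) (Dm : SignedSelmerDualData W κ γ (-1))
    {ξp ξm : IwasawaAlgebra p} (hξp : Dp.charIdeal = Ideal.span {ξp}) (hξm : Dm.charIdeal = Ideal.span {ξm}) :
    (∀ ε : ℤˣ, HasUnitContent (kobayashiL ε Lplus Lminus)) ↔
      (∃ ε₀ : ℤˣ, HasUnitContent (kobayashiL ε₀ Lplus Lminus)) ∧ mu ξp = mu ξm := by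
  constructor
  · intro h
    refine ⟨⟨1, h 1⟩, ?_⟩
    exact ((hasUnitContent_iff_mu_eq_of_hasUnitContent W p hCKJ h12 h5 h3 hp2 hgood hap hκ hγ hγc hf hL
      (h (-1)) Dm Dp hξm hξp).mp (h 1))
  · rintro ⟨⟨ε₀, h₀⟩, heq⟩ ε
    rcases Int.units_eq_one_or ε₀ with rfl | rfl
    · rcases Int.units_eq_one_or ε with rfl | rfl
      · exact h₀
      · exact (hasUnitContent_iff_mu_eq_of_hasUnitContent W p hCKJ h12 h5 h3 hp2 hgood hap hκ hγ hγc hf hL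
          h₀ Dp Dm hξp hξm).mpr heq.symm
    · rcases Int.units_eq_one_or ε with rfl | rfl
      · exact (hasUnitContent_iff_mu_eq_of_hasUnitContent W p hCKJ h12 h5 h3 hp2 hgood hap hκ hγ hγc hf hL
          h₀ Dm Dp hξm hξp).mpr heq
      · exact h₀

end SecondSign

end Summit.BirchSwinnertonDyer.BirchSwinnertonDyer.Theorems.SmallImageLowerHalfBothSignsMuRiderMuDefect

end
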